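import Mathlib
import Summits.Ventures.PercRepro.TriangleCapRowTCapArith

/-!
# PercRepro — THE CAP ON EVERY CELL `(k, a, a + j)` AGAINST THE ONE-TRIANGLE TARGET: a `K₄⁻`-free graph with
`a (k − a) − (a + j)` edges and a vertex of degree `k − a` is `a`-bipartite or at least `2k − 14 + 2j (a − 3)` below
the closed form, for EVERY `a ≥ 5`, every `j` and every `k ≥ 3a + j` (p3, gen 49; part 203e)

The one-triangle family `tFamilyGen (k − 1) a (j + 2)` (K_{a,k−a−1} minus a `(j + 2)`-star plus a vertex hung on an
edge) IS a cap graph: its hung vertex and its big neighbour form the one matching edge of `N(x)`. The skeleton of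
`cap_Aj_gen` (part 202c) without the bound `M ≤ 1` on the matching inside `N(x)`: no edge inside the non-neighbours
for `K ≥ 2a + j` (`capGen_noedge`); `M = 0` is `a`-bipartite; `M = 1` is the joint accounting of part 202a closed
with slack `0` against the one-triangle target (`capTreg_sq_arith`); `M ≥ 2` is the crude accounting with slack
`≥ 8` (`capTreg_sq_arith_M2`). This is the cap of every row `r = a + j` with `a ≤ j + 4` (part 203f), where the
one-triangle family is the closer of the two families. Axioms: standard.
-/

namespace PercRepro

namespace TriangleCap

namespace C047

open Finset

variable {V : Type*} [Fintype V] [DecidableEq V]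

set_option maxHeartbeats 400000 in
/-- **THE CAP ON THE CELL `(k, a, a + j)` AGAINST THE ONE-TRIANGLE TARGET, EVERY `a ≥ 5`, `k ≥ 3a + j`:** a `K₄⁻`-free
graph with `a (k − a) − (a + j)` edges and a vertex `x` of degree `k − a` is a spanning subgraph of some `K(A, Aᶜ)`
with `|A| = a`, or `Σ_v d(v)² + (a + j)(k − 1 − (a + j)) + (2k − 14 + 2j (a − 3)) ≤ m k`. -/
theorem cap_T_regime (D : SimpleGraph V) [DecidableRel D.Adj] (hK : K4mFree D) (a j : ℕ) (ha : 5 ≤ a)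
    (hk : 3 * a + j ≤ Fintype.card V) (hm : D.edgeFinset.card + (a + j) = a * (Fintype.card V - a)) (x : V)
    (hx : deg D x + a = Fintype.card V) :
    (∃ A : Finset V, A.card = a ∧ BipSub D A) ∨
      ∑ v, deg D v * deg D v + (a + j) * (Fintype.card V - 1 - (a + j)) +
          (2 * Fintype.card V - 14 + 2 * j * (a - 3)) ≤
        D.edgeFinset.card * Fintype.card V := by
  obtain ⟨N, hN⟩ : ∃ N : Finset V, N = univ.filter (fun w => D.Adj x w) := ⟨_, rfl⟩
  have hmemN : ∀ w, w ∈ N ↔ D.Adj x w := fun w => by rw [hN, mem_filter]; simp only [mem_univ, true_and]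
  have hxN : x ∉ N := fun h => D.irrefl ((hmemN x).mp h)
  have hdx : deg D x = N.card := by rw [hN]; rfl
  obtain ⟨K, hKdef⟩ : ∃ K, N.card = K := ⟨_, rfl⟩
  have hcardV : Fintype.card V = K + a := by omega
  obtain ⟨m, hmdef⟩ : ∃ m, D.edgeFinset.card = m := ⟨_, rfl⟩
  have hcap : ∀ v, deg D v + a ≤ Fintype.card V := fun v =>
    deg_add_le_card_of_dense D hK a (by omega) (by omega)
      (cap_arith a (Fintype.card V) D.edgeFinset.card (a + j) (by omega) (by omega)
        (below_cap_arith a (Fintype.card V) D.edgeFinset.card (a + j) (by omega) hm)) v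
  rw [hmdef, hcardV, Nat.add_sub_cancel] at hm
  obtain ⟨R, hR⟩ : ∃ R : Finset V, R = (insert x N)ᶜ := ⟨_, rfl⟩
  have hRcard : R.card + 1 = a := by
    rw [hR, card_compl, card_insert_of_notMem hxN]
    omega
  have hmemR : ∀ w, w ∈ R ↔ w ≠ x ∧ ¬ D.Adj x w := by
    intro w
    rw [hR, mem_compl, mem_insert, hmemN]
    tauto
  obtain ⟨M, hM⟩ : ∃ M, adjPairs D N = 2 * M := ⟨_, adjPairs_eq_two_mul D N⟩
  have hTf : ∑ y ∈ N, degIn D N y = 2 * M := by rw [← adjPairs_eq_sum_degIn, hM]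
  obtain ⟨P, hPdef⟩ : ∃ P, ∑ u ∈ R, degIn D N u = P := ⟨_, rfl⟩
  obtain ⟨E, hEdef⟩ : ∃ E, adjPairs D R = E := ⟨_, rfl⟩
  have hsplit : ∀ F : V → ℕ, ∑ w, F w = F x + ∑ y ∈ N, F y + ∑ u ∈ R, F u := by
    intro F
    rw [← sum_add_sum_compl (insert x N), sum_insert hxN, ← hR]
  have hdegN : ∀ y ∈ N, deg D y = 1 + degIn D N y + degIn D R y := by
    intro y hy
    have := deg_eq_of_mem_nbhd D x y ((hmemN y).mp hy)
    rw [← hN, ← hR] at this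
    exact this
  have hsumN : ∑ y ∈ N, deg D y = K + 2 * M + P := by
    rw [sum_congr rfl hdegN, sum_add_distrib, sum_add_distrib, sum_const, smul_eq_mul, mul_one, hKdef, hTf,
      sum_degIn_comm D N R, hPdef]
  have hdegR : ∀ u ∈ R, deg D u = degIn D N u + degIn D R u := by
    intro u hu
    have := deg_eq_of_not_mem_nbhd D x u ((hmemR u).mp hu).2
    rw [← hN, ← hR] at this
    exact this
  have hsumR : ∑ u ∈ R, deg D u = P + E := by
    rw [sum_congr rfl hdegR, sum_add_distrib, hPdef, ← adjPairs_eq_sum_degIn, hEdef]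
  have hdegsum := sum_deg_eq D
  rw [hsplit, hsumN, hsumR, hdx, hKdef, hmdef] at hdegsum
  have hcapK : ∀ u ∈ R, deg D u ≤ K := fun u _ => by have := hcap u; omega
  have h1 : P + E ≤ (a - 1) * K := by
    rw [← hsumR]
    calc ∑ u ∈ R, deg D u ≤ ∑ _u ∈ R, K := sum_le_sum (fun u hu => hcapK u hu)
      _ = (a - 1) * K := by rw [sum_const, smul_eq_mul]; congr 1; omega
  have hPle : ∀ u ∈ R, degIn D N u + M ≤ K := by
    intro u hu
    have := two_mul_degIn_add_adjPairs_le D hK (x := x) ((hmemR u).mp hu).1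
    rw [← hN, hM, hKdef] at this
    omega
  have h2 : P + (a - 1) * M ≤ (a - 1) * K := by
    have hs : ∑ u ∈ R, (degIn D N u + M) ≤ ∑ _u ∈ R, K := sum_le_sum hPle
    rw [sum_add_distrib, sum_const, sum_const, smul_eq_mul, smul_eq_mul, hPdef] at hs
    have e : R.card = a - 1 := by omega
    rw [e] at hs
    exact hs
  obtain ⟨a', rfl⟩ : ∃ a', a = a' + 5 := ⟨a - 5, by omega⟩
  have e1 : a' + 5 - 1 = a' + 4 := by omega
  rw [e1] at h1 h2
  -- no edge inside `R`
  have hE0 : E = 0 := by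
    by_contra hE
    obtain ⟨u, hu, hu1⟩ : ∃ u ∈ R, 1 ≤ degIn D R u := by
      by_contra hcon
      push Not at hcon
      have h0 : ∑ u ∈ R, degIn D R u = 0 := sum_eq_zero (fun u hu => by have := hcon u hu; omega)
      rw [← adjPairs_eq_sum_degIn, hEdef] at h0
      exact hE h0
    obtain ⟨v, hv, huv⟩ : ∃ v ∈ R, D.Adj u v := by
      unfold degIn at hu1
      obtain ⟨v, hv⟩ := card_pos.mp hu1
      rw [mem_filter] at hv
      exact ⟨v, hv.1, hv.2⟩
    have hne : u ≠ v := D.ne_of_adj huv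
    have hPuv : degIn D N u + degIn D N v ≤ K + 1 := by
      have := degIn_add_degIn_le_of_adj_pair D hK N huv
      rw [hKdef] at this
      exact this
    have hvR' : v ∈ R.erase u := mem_erase.mpr ⟨hne.symm, hv⟩
    have hsum1 := add_sum_erase R (fun w => degIn D N w) hu
    have hsum2 := add_sum_erase (R.erase u) (fun w => degIn D N w) hvR'
    have hsum1' := add_sum_erase R (fun w => degIn D R w) hu
    have hsum2' := add_sum_erase (R.erase u) (fun w => degIn D R w) hvR'
    have hcard2 : ((R.erase u).erase v).card = a' + 2 := by
      rw [card_erase_of_mem hvR', card_erase_of_mem hu]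
      omega
    have hrest : ∑ w ∈ (R.erase u).erase v, degIn D N w + (a' + 2) * M ≤ (a' + 2) * K := by
      have hs : ∑ w ∈ (R.erase u).erase v, (degIn D N w + M) ≤ ∑ _w ∈ (R.erase u).erase v, K :=
        sum_le_sum (fun w hw => hPle w (mem_of_mem_erase (mem_of_mem_erase hw)))
      rw [sum_add_distrib, sum_const, sum_const, smul_eq_mul, smul_eq_mul, hcard2] at hs
      exact hs
    have hr : ∑ w ∈ (R.erase u).erase v, degIn D N w + ∑ w ∈ (R.erase u).erase v, degIn D R w ≤ (a' + 2) * K := by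
      rw [← sum_add_distrib]
      calc ∑ w ∈ (R.erase u).erase v, (degIn D N w + degIn D R w)
          = ∑ w ∈ (R.erase u).erase v, deg D w :=
            sum_congr rfl (fun w hw => (hdegR w (mem_of_mem_erase (mem_of_mem_erase hw))).symm)
        _ ≤ ∑ _w ∈ (R.erase u).erase v, K :=
            sum_le_sum (fun w hw => hcapK w (mem_of_mem_erase (mem_of_mem_erase hw)))
        _ = (a' + 2) * K := by rw [sum_const, smul_eq_mul, hcard2]
    have hu' : degIn D N u + degIn D R u ≤ K := by rw [← hdegR u hu]; exact hcapK u hu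
    have hv' : degIn D N v + degIn D R v ≤ K := by rw [← hdegR v hv]; exact hcapK v hv
    have hdu : degIn D R u ≤ a' + 3 := by
      have := degIn_le_card_erase D R u
      rw [card_erase_of_mem hu] at this
      omega
    have hdv : degIn D R v ≤ a' + 3 := by
      have := degIn_le_card_erase D R v
      rw [card_erase_of_mem hv] at this
      omega
    have hEsum : E = degIn D R u + (degIn D R v + ∑ w ∈ (R.erase u).erase v, degIn D R w) := by
      rw [← hEdef, adjPairs_eq_sum_degIn, ← hsum1', ← hsum2']
    have hPsum : P = degIn D N u + (degIn D N v + ∑ w ∈ (R.erase u).erase v, degIn D N w) := by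
      rw [← hPdef, ← hsum1, ← hsum2]
    have hm7 : m + (a' + 5 + j) = (a' + 5) * K := by omega
    exact capGen_noedge a' j K M P E m _ _ _ _ _ _ (by omega) hdegsum hm7 h1 hPuv hrest (by rw [hPsum]; ring)
      (by rw [hEsum]; ring) hu' hv' hr hdu hdv
  have hnoR : ∀ u ∈ R, degIn D R u = 0 := by
    intro u hu
    have hle : degIn D R u ≤ ∑ z ∈ R, degIn D R z := single_le_sum (fun _ _ => Nat.zero_le _) hu
    rw [← adjPairs_eq_sum_degIn, hEdef, hE0] at hle
    exact Nat.le_zero.mp hle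
  have hdegRu : ∀ t ∈ R, deg D t = degIn D N t := fun t ht => by
    rw [hdegR t ht, hnoR t ht, add_zero]
  have hP : P + (a' + 5 + j + M) + K = (a' + 5) * K := by omega
  rcases Nat.eq_zero_or_pos M with hM0 | hMpos
  · left
    have hnoN : ∀ y ∈ N, ∀ y', D.Adj y y' → y' ∉ N := by
      intro y hy y' hyy' hy'
      have h0 : degIn D N y = 0 := by
        have hle : degIn D N y ≤ ∑ z ∈ N, degIn D N z := single_le_sum (fun _ _ => Nat.zero_le _) hy
        rw [hTf, hM0, mul_zero] at hle
        exact Nat.le_zero.mp hle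
      unfold degIn at h0
      rw [card_eq_zero, filter_eq_empty_iff] at h0
      exact h0 hy' hyy'
    have hnoR' : ∀ u ∈ R, ∀ u', D.Adj u u' → u' ∉ R := by
      intro u hu u' huu' hu'
      have h0 := hnoR u hu
      unfold degIn at h0
      rw [card_eq_zero, filter_eq_empty_iff] at h0
      exact h0 hu' huu'
    refine ⟨Nᶜ, ?_, ?_⟩
    · rw [card_compl, hKdef]
      omega
    · intro p q hpq
      rw [mem_compl, mem_compl, not_not]
      constructor
      · intro hpN
        by_contra hqN
        by_cases hpx : p = x
        · subst hpx
          exact hqN ((hmemN q).mpr hpq)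
        by_cases hqx : q = x
        · subst hqx
          exact hpN ((hmemN p).mpr (D.adj_symm hpq))
        have hpR : p ∈ R := (hmemR p).mpr ⟨hpx, fun h => hpN ((hmemN p).mpr h)⟩
        have hqR : q ∈ R := (hmemR q).mpr ⟨hqx, fun h => hqN ((hmemN q).mpr h)⟩
        exact hnoR' p hpR q hpq hqR
      · intro hqN hpN
        exact hnoN p hpN q hpq hqN
  right
  rw [hsplit (fun v => deg D v * deg D v), hdx, hKdef, hmdef, hcardV]
  have hSRdeg : ∑ u ∈ R, deg D u * deg D u = ∑ u ∈ R, degIn D N u * degIn D N u :=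
    sum_congr rfl (fun t ht => by rw [hdegRu t ht])
  rcases Nat.lt_or_ge M 2 with hM1 | hM2
  · -- `M = 1`: the joint accounting of part 202a
    have hM1'' : M = 1 := by omega
    subst hM1''
    have hPle' : ∀ u ∈ R, degIn D N u + 1 ≤ K := hPle
    have hsumR' : ∑ u ∈ R, degIn D N u + (j + 2) = R.card * (K - 1) := by
      rw [hPdef]
      have e : R.card = a' + 4 := by omega
      rw [e]
      obtain ⟨K', rfl⟩ : ∃ K', K = K' + 1 := ⟨K - 1, by omega⟩
      rw [Nat.add_sub_cancel]
      nlinarith [hP]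
    obtain ⟨np, hnp⟩ : ∃ np, (R.filter (fun u => degIn D N u + 2 ≤ K)).card = np := ⟨_, rfl⟩
    have hnpR : np + 1 ≤ a' + 5 := by
      rw [← hnp]
      have := card_le_card (filter_subset (fun u => degIn D N u + 2 ≤ K) R)
      omega
    have hSR := capGen_R_sum D R N K (j + 2) hPle' hsumR'
    rw [hnp] at hSR
    have hSR' : ∑ u ∈ R, deg D u * deg D u + 2 * (j + 2) * (K - 1) + (j + 2) * np ≤
        (a' + 5 - 1) * ((K - 1) * (K - 1)) + (j + 2) * (j + 3) := by
      rw [hSRdeg]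
      have e : R.card = a' + 5 - 1 := by omega
      rw [← e]
      exact hSR
    have hfg_le : 2 * ∑ y ∈ N, degIn D N y * degIn D R y ≤ 2 * (a' + 4) := by
      have := two_mul_sum_degIn_mul_degIn_le D hK x R (fun u hu => ((hmemR u).mp hu).1)
      rw [← hN, hM] at this
      have e : R.card = a' + 4 := by omega
      rw [e] at this
      omega
    have hf1 : ∀ y ∈ N, degIn D N y ≤ 1 := fun y hy => by
      have h1 := degIn_nbhd_le_one D hK (x := x) (u := y) ((hmemN y).mp hy)
      rw [← hN] at h1
      exact h1
    have hfg_le' : 2 * ∑ y ∈ N, degIn D N y * degIn D R y ≤ 2 * (a' + 5 - 1) := by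
      have e : a' + 5 - 1 = a' + 4 := by omega
      rw [e]
      exact hfg_le
    -- the triangle edge `y₁ y₂` of `N`
    obtain ⟨y₁, hy₁N, hy₁pos⟩ : ∃ y₁ ∈ N, 1 ≤ degIn D N y₁ := by
      by_contra hcon
      push Not at hcon
      have h0 : ∑ y ∈ N, degIn D N y = 0 := sum_eq_zero (fun y hy => by have := hcon y hy; omega)
      rw [hTf] at h0
      omega
    obtain ⟨y₂, hy₂N, h12⟩ : ∃ y₂ ∈ N, D.Adj y₁ y₂ := by
      unfold degIn at hy₁pos
      obtain ⟨y₂, hy₂⟩ := card_pos.mp hy₁pos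
      rw [mem_filter] at hy₂
      exact ⟨y₂, hy₂.1, hy₂.2⟩
    have hmissR : ∀ y, a' + 5 - 1 - degIn D R y = (R.filter (fun u => ¬ D.Adj y u)).card := fun y => by
      have h := card_filter_add_card_filter_not (s := R) (fun u => D.Adj y u)
      unfold degIn
      omega
    have hNE : ∀ y ∈ N, degIn D N y = 0 → a' + 5 - 1 - degIn D R y ≤ np := by
      intro y hy hy0
      rw [hmissR y, ← hnp]
      apply card_le_card
      intro u hu
      rw [mem_filter] at hu
      rw [mem_filter]
      refine ⟨hu.1, ?_⟩
      rw [← hKdef]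
      exact rowA1_nonend_miss D hK x N hmemN y₁ y₂ hy₁N hy₂N h12 y hy hy0 u ((hmemR u).mp hu.1).1
        (fun h => hu.2 (D.adj_symm h))
    have hE2 : ∀ z₁ ∈ N, ∀ z₂ ∈ N, z₁ ≠ z₂ → degIn D N z₁ = 1 → degIn D N z₂ = 1 →
        (a' + 5 - 1 - degIn D R z₁) + (a' + 5 - 1 - degIn D R z₂) ≤ (a' + 5 - 1) + np := by
      intro z₁ hz₁ z₂ hz₂ hne _ _
      rw [hmissR z₁, hmissR z₂]
      have h := rowA1_ends_miss D R N z₁ z₂ hz₁ hz₂ hne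
      rw [hKdef, hnp] at h
      omega
    have hP' : P + (a' + 5 + (j + 2) - 1) + K = (a' + 5) * K := by
      have e : a' + 5 + (j + 2) - 1 = a' + 5 + j + 1 := by omega
      rw [e]
      omega
    have hSN := capGen_N_sum D N R K (a' + 5) P np (j + 2) (by omega) hKdef (by omega) hdegN hf1 (by rw [hTf])
      (by rw [sum_degIn_comm D N R]; exact hPdef) hfg_le' hP' hNE hE2
    exact capTreg_sq_arith (a' + 5) j K P _ _ np m (by omega) hnpR (by omega) hm (by omega) hSN hSR'
  · -- `M ≥ 2`: the crude accounting
    obtain ⟨δ, hδ⟩ : ∃ δ, (a' + 5 - 2) * M + δ = a' + 5 + j := ⟨a' + 5 + j - (a' + 5 - 2) * M, by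
      have e : a' + 5 - 2 = a' + 3 := by omega
      rw [e]
      have h3 : (a' + 3) * M ≤ a' + 5 + j := by linarith [h2, hP]
      omega⟩
    have hsumR' : ∑ u ∈ R, degIn D N u + δ = R.card * (K - M) := by
      rw [hPdef]
      have e : R.card = a' + 4 := by omega
      rw [e]
      have e2 : a' + 5 - 2 = a' + 3 := by omega
      rw [e2] at hδ
      have hMK : M ≤ K := by
        obtain ⟨u, hu⟩ : ∃ u, u ∈ R := by
          have : 0 < R.card := by omega
          exact card_pos.mp this
        have := hPle u hu
        omega
      obtain ⟨K', hK'⟩ : ∃ K', K = M + K' := ⟨K - M, by omega⟩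
      subst hK'
      rw [Nat.add_sub_cancel_left]
      linarith [hP, hδ]
    have hSR := sum_sq_le_of_le_deficit R (fun u => degIn D N u) (K - M) δ (fun u hu => by have := hPle u hu; omega)
      hsumR'
    have hSR' : ∑ u ∈ R, deg D u * deg D u + 2 * δ * (K - M) ≤ (a' + 5 - 1) * ((K - M) * (K - M)) + δ * δ := by
      rw [hSRdeg]
      have e : R.card = a' + 5 - 1 := by omega
      rw [← e]
      exact hSR
    have hfg_le : 2 * ∑ y ∈ N, degIn D N y * degIn D R y ≤ 2 * M * (a' + 5 - 1) := by
      have := two_mul_sum_degIn_mul_degIn_le D hK x R (fun u hu => ((hmemR u).mp hu).1)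
      rw [← hN, hM] at this
      have e : R.card = a' + 5 - 1 := by omega
      rw [e] at this
      have e2 : 2 * M * (a' + 5 - 1) = (a' + 5 - 1) * (2 * M) := by ring
      rw [e2]
      exact this
    have hf1 : ∀ y ∈ N, degIn D N y ≤ 1 := fun y hy => by
      have h1 := degIn_nbhd_le_one D hK (x := x) (u := y) ((hmemN y).mp hy)
      rw [← hN] at h1
      exact h1
    have hg : ∀ y ∈ N, degIn D R y + 1 ≤ a' + 5 := fun y _ =>
      calc degIn D R y + 1 ≤ R.card + 1 := Nat.add_le_add_right (degIn_le_card D R y) 1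
        _ = a' + 5 := hRcard
    have hpt : ∀ y ∈ N, deg D y * deg D y ≤
        1 + 3 * degIn D N y + (a' + 5 + 1) * degIn D R y + 2 * (degIn D N y * degIn D R y) := fun y hy => by
      rw [hdegN y hy]
      exact cap_sq_bound_gen _ _ _ (hf1 y hy) (hg y hy)
    have hSN : ∑ y ∈ N, deg D y * deg D y ≤ K + 6 * M + (a' + 5 + 1) * P + 2 * M * (a' + 5 - 1) := by
      have h := sum_le_sum hpt
      rw [sum_add_distrib, sum_add_distrib, sum_add_distrib, sum_const, smul_eq_mul, mul_one, hKdef, ← mul_sum,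
        ← mul_sum, ← mul_sum, hTf, sum_degIn_comm D N R, hPdef] at h
      omega
    exact capTreg_sq_arith_M2 (a' + 5) j K M P _ _ δ m (by omega) hM2 (by omega) hm hP hδ hSN hSR'

end C047

end TriangleCap

end PercRepro
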